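import Summits.ResolutionOfSingularities.ResolutionOfSingularities.Theorems.WeightedInvariantIota3TauDescentExtReesBaseChange
import Summits.ResolutionOfSingularities.ResolutionOfSingularities.Theorems.WeightedInvariantP3aTieFreeDrop
import HarnessLib

/-!
# (desc-τ), CASE B REDUCED TO THE DESCENT OF AN ADAPTED PRESENTATION: equal-dimension descent of tie positions, GIVEN an rsp-adapted
# Abramovich–Quek–Schober datum downstairs (door `HypersurfaceCentreConstruction`, stmt-ResolutionOfSingularities-19897; gap (1) (desc-τ), case B)

Topic: `Summits/ResolutionOfSingularities/ResolutionOfSingularities/Theorems`. Helper for the door item `HypersurfaceCentreConstruction`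
(stmt-ResolutionOfSingularities-19897, route `WeightedInvariant`), line `local-engine`, def-free.  Case (B) of `Iota3.isTiePosition_descent_of_cases`
(…Iota3TauDescentLowDim): `φ : T → T'` local, formally smooth, essentially of finite type, `dim T = dim T' = 3` (so `𝔪_T T' = 𝔪_{T'}`), `(T', φ g)` a tie
position ⇒ `(T, g)` a tie position.  THIS FILE proves it GIVEN an rsp-adapted lex-maximal datum downstairs — a regular system of parameters
`(x, y, z)` of `T` with `(x, y) = P₀(T, g)` and `(y/1, x/1; w; ℓ)` lex-maximal for `(g/1) ⊆ T_{P₀}` — by the flat-pullback argument of case A′ run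
backwards:

* `Iota3.IsLexMaxWeightedCentreGerm.swap_one_one` — at weights `(1, 1)` the datum is symmetric in its two variables.
* **`Iota3.isTiePosition_of_adapted_datum`** — the datum ascends to `T'_{P₀T'}` (`isLexMaxWeightedCentreGerm_atPrime_map`), so by AQS uniqueness
  (…TiePresentationTransfer) the tie presentation upstairs has the weights `(r, q) = w` and the filtration `𝒥ₙ((φy, φx); (r, q)) = 𝒥ₙ((y, x); (r, q))·T'`;
  the tie gives a no-drop successor of `B' = T'[t⁻¹, 𝒥'ₙ tⁿ]` over `𝔪'` (…TieNoDropSuccessor), which contracts along the flat base change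
  `ψ : B → B'` (`ExtReesMap.exists_baseChange`, orders preserved) to a successor of `B = T[t⁻¹, 𝒥ₙ tⁿ]` over `𝔪_T`, through `z`, off the vertex, where
  the saturated transform `g t^{rν}` keeps order `≥ ν`; by `LocalGameEFTCylinder.adicOrder_transform_lt_of_tieFree` (…P3aTieFreeDrop) the position
  `(T, g)` is therefore NOT tie-free for `(y, x, z; r, q)`: some `λ ∈ T` (or, at `q = r = 1`, the swapped curve) presents a tie at `T`.
What remains of case (B) after this file is the purely `T`-side question «an rsp-adapted lex-maximal datum exists at `(T, g)` whenever `(T', φ g)` is a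
tie position» (memo TAU-DESCENT-A.md §3: the prime numerator of the maximal-contact element may lie in `𝔪_T²`).

[OURS · L1 W4.3 · (desc-τ) case B modulo adapted presentations]  Replaces the role of NO printed item; NOT a statement of the manuscript under review
[claim: Hironaka2017, status: under-review]; candidates stay candidates; AI work, weaker than expert review.  No definition; no axiom.

## References

* D. Abramovich, M. H. Quek, B. Schober, arXiv:2507.01232 (2025), Thm 1.3 (3), Thm 3.5. [AbramovichQuekSchober2025]
* J. Włodarczyk, *Functorial resolution by torus actions*, arXiv:2203.03090, §2.3.9, §3.3, App. Def. 5.1.1. [Wlodarczyk2022]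
-/

noncomputable section

set_option linter.dupNamespace false -- mandated namespace `Summit.<Summit>.<Problem>` of this single-conjunct summit

open IsLocalRing Literature.AlgebraicGeometry.Resolution
open Summit.ResolutionOfSingularities.ResolutionOfSingularities.Theorems
open Summit.ResolutionOfSingularities.ResolutionOfSingularities.Theorems.ContactCylinder

namespace Summit.ResolutionOfSingularities.ResolutionOfSingularities.Cruxes.HypersurfaceCentreConstruction.LocalEngine

namespace Iota3

/-! ## §1 Symmetry of the datum at weights `(1, 1)` -/

/-- **At weights `(1, 1)` the lex-maximal datum is symmetric in its variables.** [cite: AbramovichQuekSchober2025, Thm 3.5] -/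
theorem IsLexMaxWeightedCentreGerm.swap_one_one {O : Type} [CommRing O] [IsLocalRing O] {I : Ideal O} {a b : O} {ℓ : ℕ}
    (h : IsLexMaxWeightedCentreGerm O I ![a, b] ![1, 1] ℓ) : IsLexMaxWeightedCentreGerm O I ![b, a] ![1, 1] ℓ := by
  obtain ⟨hspan, hpos, hcop, hle, hℓ, hdvd, hadm, hmax, huniq⟩ := h
  have hrange : Set.range ![b, a] = Set.range ![a, b] := by
    rw [Matrix.range_cons, Matrix.range_cons, Matrix.range_empty, Set.union_empty, Set.singleton_union,
      Matrix.range_cons, Matrix.range_cons, Matrix.range_empty, Set.union_empty, Set.singleton_union, Set.pair_comm]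
  have hswap : ∀ n, weightedMonomialIdeal ![b, a] ![1, 1] n = weightedMonomialIdeal ![a, b] ![1, 1] n :=
    fun n => (AQSHeightTwo.weightedMonomialIdeal_swap a b 1 1 n).symm
  refine ⟨by rw [hrange, hspan], hpos, hcop, hle, hℓ, hdvd, by rw [hswap]; exact hadm, hmax, fun y' hy' hI n => ?_⟩
  rw [hswap n]
  exact huniq y' hy' hI n

/-! ## §2 Equal-dimension descent from an adapted datum -/

section CaseB

variable (T T' : Type) [CommRing T] [CommRing T'] [IsRegularLocalRing T] [IsRegularLocalRing T'] [Algebra T T']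
  [IsLocalHom (algebraMap T T')] [Algebra.FormallySmooth T T'] [Algebra.EssFiniteType T T']

/-- **CASE B OF (desc-τ) FROM AN rsp-ADAPTED DATUM DOWNSTAIRS.**  See the module docstring.
[OURS · (desc-τ) case B engine] [cite: AbramovichQuekSchober2025, Thm 1.3 (3)] -/
theorem isTiePosition_of_adapted_datum (hdimT : ringKrullDim T = (3 : ℕ)) {g : T} (ht' : IsTiePosition T' (algebraMap T T' g))
    {x y z : T} [hP : (Ideal.span ({x, y} : Set T)).IsPrime] (hxyz : Ideal.span {x, y, z} = maximalIdeal T)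
    (hP₀ : topStratumPrime iotaOrdEps T g = Ideal.span {x, y}) {w : Fin 2 → ℕ} {ℓ : ℕ}
    (hlexT : IsLexMaxWeightedCentreGerm (Localization.AtPrime (Ideal.span ({x, y} : Set T)))
      (Ideal.span {algebraMap T (Localization.AtPrime (Ideal.span ({x, y} : Set T))) g})
      ![algebraMap T (Localization.AtPrime (Ideal.span ({x, y} : Set T))) y,
        algebraMap T (Localization.AtPrime (Ideal.span ({x, y} : Set T))) x] w ℓ) :
    IsTiePosition T g := by
  classical
  -- dimensions, `𝔪_T T' = 𝔪'`, flatness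
  obtain ⟨hdimT'n, -⟩ := ringKrullDim_eq_of_isTiePosition_map T T' ht'
  have hdim3 : ringKrullDim T = 3 := by rw [hdimT]; rfl
  have hdim3' : ringKrullDim T' = 3 := by rw [hdimT'n]; rfl
  have h𝔪 : (maximalIdeal T).map (algebraMap T T') = maximalIdeal T' :=
    EssSmoothLE2.map_maximalIdeal_eq_of_ringKrullDim_eq T T' (by rw [hdimT, hdimT'n])
  haveI : Module.Flat T T' := IotaOrderEssSmooth.flat_of_formallySmooth_of_essFiniteType T T'
  -- the tie upstairs
  have ht'' := ht'
  obtain ⟨_, -, hε', -, x', y', z', q, r, lam', h'⟩ := ht''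
  have h'' := h'
  obtain ⟨hxyz', hP₀', ν, hP', hfν, hfν1, hlex', -⟩ := h''
  -- `g`: order `ν ≥ 2`, not of monomial type, `ε = 0`
  obtain ⟨hgν, hgν1⟩ := mem_pow_and_not_mem_of_map T T' hfν hfν1
  have h2 : 2 ≤ ν := two_le_of_isTiePosition_map T T' ht' hgν hgν1
  have hg0 : g ≠ 0 := fun h0 => ht'.ne_zero (by rw [h0, map_zero])
  have hg𝔪 : g ∈ maximalIdeal T := by
    refine (IsLocalRing.mem_maximalIdeal g).mpr (mem_nonunits_iff.mpr fun hu => ?_)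
    exact (IsLocalRing.mem_maximalIdeal _).mp ht'.mem_maximalIdeal (hu.map (algebraMap T T'))
  have hnm : ¬ IsMonomialType g := not_isMonomialType_of_isTiePosition_map T T' ht'
  have hν : iotaOrd T g = ν := (iotaOrd_eq_natCast_iff T g ν).mpr ⟨hgν, hgν1⟩
  have hε : iotaEps T g = 0 := by rw [← iotaEps_essSmooth_eq T T' g]; exact hε'
  -- the top stratum `V(P₀)` and its extension `P₀ T' = (φ x, φ y) = P₀'`
  obtain ⟨hP₀p, hreg, -, hE, -, -⟩ := topStratumPrime_iotaOrdEps_spec (le_of_eq hdim3) hg0 hg𝔪 hν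
  obtain ⟨hP₀'p, -, -, hP₀map⟩ := topStratumPrime_iotaOrdEps_map_eq T T' g hreg hE
  have hPmap : (topStratumPrime iotaOrdEps T g).map (algebraMap T T') =
      Ideal.span {algebraMap T T' x, algebraMap T T' y} := by rw [hP₀, map_span_pair]
  haveI hPxy' : (Ideal.span ({algebraMap T T' x, algebraMap T T' y} : Set T')).IsPrime := hPmap ▸ hP₀'p
  have hP₀'' : topStratumPrime iotaOrdEps T' (algebraMap T T' g) = Ideal.span {algebraMap T T' x, algebraMap T T' y} :=
    hP₀map.trans hPmap
  -- `dim T ⧸ (x, y) = 1`, `dim T_{(x,y)} = 2`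
  have hsf : (maximalIdeal T).spanFinrank = 3 := spanFinrank_eq_three_of_ringKrullDim hdim3
  have hq1 : ringKrullDim (T ⧸ topStratumPrime iotaOrdEps T g) = 1 := by
    have h := ringKrullDim_quotient_span_pair x y z hxyz hsf
    have hcongr : ∀ (I J : Ideal T), I = J → ringKrullDim (T ⧸ I) = ringKrullDim (T ⧸ J) := by rintro I J rfl; rfl
    rw [hcongr _ _ hP₀, h]
  have hdimP : ringKrullDim (Localization.AtPrime (Ideal.span ({x, y} : Set T))) = (2 : ℕ) := by
    refine le_antisymm (ringKrullDim_atPrime_span_pair_le_two x y) ?_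
    have hmem : (⟨Ideal.span {x, y}, hP⟩ : PrimeSpectrum T) ∈ topStratum iotaOrd T g := by
      rw [← topStratum_iotaOrdEps_eq_topStratum_iotaOrd_of_iotaEps_eq_zero hg𝔪 hε, hE, Set.mem_setOf_eq, hP₀]
    have hht := two_le_height_of_mem_topStratum_iotaOrd hg0 hg𝔪 hnm hmem
    dsimp only at hht
    rw [IsLocalization.AtPrime.ringKrullDim_eq_height (Ideal.span ({x, y} : Set T)) (Localization.AtPrime (Ideal.span ({x, y} : Set T)))]
    have h2 : ((2 : ℕ) : WithBot ℕ∞) = (((2 : ℕ) : ℕ∞) : WithBot ℕ∞) := rfl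
    rw [h2]
    exact WithBot.coe_le_coe.mpr (by exact_mod_cast hht)
  -- the datum ascends to `T'_{(φ x, φ y)}`
  have hlexUp := isLexMaxWeightedCentreGerm_atPrime_map T T' x y g hdimP hlexT
  -- the rsp maps to an rsp
  have hxyz'' : Ideal.span {algebraMap T T' x, algebraMap T T' y, algebraMap T T' z} = maximalIdeal T' := by
    rw [← map_span_triple, hxyz, h𝔪]
  have hyxz'' : Ideal.span (Set.range ![algebraMap T T' y, algebraMap T T' x, algebraMap T T' z]) = maximalIdeal T' := by
    rw [← hxyz'', Matrix.range_cons, Matrix.range_cons, Matrix.range_cons, Matrix.range_empty, Set.union_empty,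
      Set.singleton_union, Set.singleton_union, Set.insert_comm]
  have hsf' : (maximalIdeal T').spanFinrank = 3 := spanFinrank_eq_three_of_ringKrullDim hdim3'
  have hu : ∀ i, (![algebraMap T T' y, algebraMap T T' x] : Fin 2 → T') i ∈ maximalIdeal T' :=
    LocalGameEFTCylinder.mem_maximalIdeal_pair hyxz''
  have hli := LocalGameEFTCylinder.linearIndependent_toCotangent_pair hyxz'' hsf'
  have huP : ∀ i, (![algebraMap T T' y, algebraMap T T' x] : Fin 2 → T') i ∈
      Ideal.span ({algebraMap T T' x, algebraMap T T' y} : Set T') := by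
    intro i; fin_cases i
    · exact Ideal.subset_span (Set.mem_insert_of_mem _ (Set.mem_singleton _))
    · exact Ideal.subset_span (Set.mem_insert _ _)
  have hfun : (fun i => algebraMap T' (Localization.AtPrime (Ideal.span ({algebraMap T T' x, algebraMap T T' y} : Set T')))
        ((![algebraMap T T' y, algebraMap T T' x] : Fin 2 → T') i)) =
      ![algebraMap T' (Localization.AtPrime (Ideal.span ({algebraMap T T' x, algebraMap T T' y} : Set T'))) (algebraMap T T' y),
        algebraMap T' (Localization.AtPrime (Ideal.span ({algebraMap T T' x, algebraMap T T' y} : Set T'))) (algebraMap T T' x)] := by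
    funext i; fin_cases i <;> rfl
  rw [← hfun] at hlexUp
  -- AQS uniqueness: the tie presentation has the weights `w = (r, q)`, `ℓ = rν`, and the extended filtration
  obtain ⟨hw, hℓ, hfil⟩ := h'.weightedMonomialIdeal_eq_of_isLexMax hdim3' hfν hfν1
    (Ideal.span ({algebraMap T T' x, algebraMap T T' y} : Set T')) hP₀'' hu hli huP hlexUp
  subst hw hℓ
  have hfil' : ∀ n, weightedMonomialIdeal ![y', x'] ![r, q] n = (weightedMonomialIdeal ![y, x] ![r, q] n).map (algebraMap T T') :=
    fun n => by rw [AQSBaseChange.map_weightedMonomialIdeal_two, ← hfil n]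
  -- weights
  obtain ⟨-, hpos, hcop, hqr, -, -, hadmLoc, -, -⟩ := id hlexT
  have hr : 0 < r := hpos 0
  have hq : 0 < q := hpos 1
  have hqr' : q ≤ r := hqr
  have hcop' : Nat.Coprime r q := hcop
  -- admissibility downstairs: `g ∈ 𝒥_{rν}((y, x); (r, q))` (contracted from `T_{(x,y)}`)
  have hyxz : Ideal.span (Set.range ![y, x, z]) = maximalIdeal T := by
    rw [← hxyz, Matrix.range_cons, Matrix.range_cons, Matrix.range_cons, Matrix.range_empty, Set.union_empty,
      Set.singleton_union, Set.singleton_union, Set.insert_comm]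
  have huT : ∀ i, (![y, x] : Fin 2 → T) i ∈ maximalIdeal T := LocalGameEFTCylinder.mem_maximalIdeal_pair hyxz
  have hliT := LocalGameEFTCylinder.linearIndependent_toCotangent_pair hyxz hsf
  have huPT : ∀ i, (![y, x] : Fin 2 → T) i ∈ Ideal.span ({x, y} : Set T) := by
    intro i; fin_cases i
    · exact Ideal.subset_span (Set.mem_insert_of_mem _ (Set.mem_singleton _))
    · exact Ideal.subset_span (Set.mem_insert _ _)
  have hadm : g ∈ weightedMonomialIdeal ![y, x] ![r, q] (r * ν) := by
    rw [← comap_map_weightedMonomialIdeal_eq_of_linearIndependent (Ideal.span ({x, y} : Set T)) ![y, x] huT hliT huPT ![r, q]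
      hpos (Nat.mul_pos hr (by omega)), Ideal.mem_comap]
    have h1 := hadmLoc (Ideal.mem_span_singleton_self _)
    rwa [AQSBaseChange.map_weightedMonomialIdeal_two]
  -- the base change `ψ : B → B'` and the transform downstairs
  obtain ⟨ψ, hψa, hψt, hψV, hψord⟩ := ExtReesMap.exists_baseChange T T' x' y' y x q r hfil'
  obtain ⟨G, -, hgG, hsat⟩ := exists_transform_of_mem T ![y, x] ![r, q] (Nat.mul_pos hr (by omega)) hadm
  have hy𝔪 : y ∈ maximalIdeal T := huT 0
  have hx𝔪 : x ∈ maximalIdeal T := huT 1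
  have hGsat : ¬ extReesAlgebra.tInv (weightedMonomialIdeal ![y, x] ![r, q]) ∣ G := fun hdvd => by
    have hmem := hsat hdvd
    have hle := AQSHeightTwo.le_pow_of_weights_le (S := T) hy𝔪 hx𝔪 (q := r) (r := q) (W := r) le_rfl hqr' ν
    rw [Nat.mul_comm ν r] at hle
    exact hgν1 (hle hmem)
  have hfg : algebraMap T' (extReesAlgebra (weightedMonomialIdeal ![y', x'] ![r, q])) (algebraMap T T' g) =
      extReesAlgebra.tInv (weightedMonomialIdeal ![y', x'] ![r, q]) ^ (r * ν) * ψ G := by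
    rw [← hψa, hgG, map_mul, map_pow, hψt]
  -- the no-drop successor upstairs and its contraction
  obtain ⟨𝔫, htInv𝔫, -, huT', hcomap, -, hord⟩ := h'.exists_successor_le_adicOrder hdim3' hfν hfν1 hfg
  set 𝔫₀ : Ideal (extReesAlgebra (weightedMonomialIdeal ![y, x] ![r, q])) := 𝔫.asIdeal.comap ψ with h𝔫₀
  have htInv₀ : extReesAlgebra.tInv (weightedMonomialIdeal ![y, x] ![r, q]) ∈ 𝔫₀ := by
    rw [h𝔫₀, Ideal.mem_comap, hψt]; exact htInv𝔫
  have hz₀ : algebraMap T (extReesAlgebra (weightedMonomialIdeal ![y, x] ![r, q])) z ∈ 𝔫₀ := by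
    have hz' : algebraMap T T' z ∈ maximalIdeal T' := map_nonunit (algebraMap T T') z
      (hxyz ▸ Ideal.subset_span (Set.mem_insert_of_mem _ (Set.mem_insert_of_mem _ (Set.mem_singleton _))))
    rw [h𝔫₀, Ideal.mem_comap, hψa, ← Ideal.mem_comap, hcomap]
    exact hz'
  have hV₀ : ¬ extReesAlgebra.vertexIdeal (weightedMonomialIdeal ![y, x] ![r, q]) ≤ 𝔫₀ := fun hle => by
    apply huT'
    have h1 : LocalGameEFTPointMove.uT ![y', x'] ![r, q] 1 ∈ extReesAlgebra.vertexIdeal (weightedMonomialIdeal ![y', x'] ![r, q]) := by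
      refine Ideal.subset_span ⟨q, hq, x', ?_, rfl⟩
      exact mem_weightedMonomialIdeal_self ![y', x'] ![r, q] 1
    have h2 : (extReesAlgebra.vertexIdeal (weightedMonomialIdeal ![y, x] ![r, q])).map ψ ≤ 𝔫.asIdeal := by
      rw [Ideal.map_le_iff_le_comap]; exact hle
    exact h2 (hψV h1)
  have hordG : (ν : ℕ∞) ≤ adicOrder (algebraMap _ (Localization.AtPrime 𝔫₀) G) := hord.trans (hψord 𝔫.asIdeal G)
  -- so `(T, g)` is NOT tie-free for `(y, x, z; r, q)`
  haveI hPyx : (Ideal.span (Set.range ![y, x])).IsPrime := by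
    have hr2 : Set.range ![y, x] = ({x, y} : Set T) := by
      rw [Matrix.range_cons, Matrix.range_cons, Matrix.range_empty, Set.union_empty, Set.singleton_union, Set.pair_comm]
    rw [hr2]; exact hP
  have key : (∃ lam : T, g ∈ weightedMonomialIdeal ![x, y - lam * x ^ r, z] ![q, r + 1, 1] ((r + 1) * ν)) ∨
      (q = r ∧ g ∈ weightedMonomialIdeal ![y, x, z] ![1, 2, 1] (2 * ν)) := by
    by_contra hno
    push Not at hno
    have hlt := LocalGameEFTCylinder.adicOrder_transform_lt_of_tieFree hyxz hsf hq hqr' hcop' (by omega : 1 ≤ ν) hgν1 hadm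
      hno.1 hno.2 𝔫₀ htInv₀ hz₀ hV₀ hgG hGsat
    exact absurd (hordG.trans_lt hlt) (lt_irrefl _)
  -- either alternative presents a tie at `T`
  rcases key with ⟨lam, hmem⟩ | ⟨hqr_eq, hmem⟩
  · exact ⟨inferInstance, hdim3, hε, hq1, x, y, z, q, r, lam, hxyz, hP₀, ν, hP, hgν, hgν1, hlexT, hmem⟩
  · -- `q = r`, hence `q = r = 1`: the swapped curve `(y, x, z; 1, 1; 0)`
    subst hqr_eq
    have hr1 : q = 1 := by
      have h := hcop'
      unfold Nat.Coprime at h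
      rwa [Nat.gcd_self] at h
    subst hr1
    haveI hQ : (Ideal.span ({y, x} : Set T)).IsPrime := by rw [Set.pair_comm]; exact hP
    have hPQ : (Ideal.span ({x, y} : Set T)).map ((RingEquiv.refl T : T ≃+* T) : T →+* T) = Ideal.span {y, x} := by
      rw [map_span_pair, Set.pair_comm]; rfl
    have hI : (Ideal.span {algebraMap T (Localization.AtPrime (Ideal.span ({x, y} : Set T))) g}).map
        ((locRingEquiv (RingEquiv.refl T) (Ideal.span ({x, y} : Set T)) (Ideal.span ({y, x} : Set T)) hPQ :
          _ ≃+* _) : _ →+* _) = Ideal.span {algebraMap T (Localization.AtPrime (Ideal.span ({y, x} : Set T))) g} := by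
      have he : (locRingEquiv (RingEquiv.refl T) (Ideal.span ({x, y} : Set T)) (Ideal.span ({y, x} : Set T)) hPQ :
            Localization.AtPrime (Ideal.span ({x, y} : Set T)) →+* Localization.AtPrime (Ideal.span ({y, x} : Set T)))
            (algebraMap T _ g) = algebraMap T (Localization.AtPrime (Ideal.span ({y, x} : Set T))) g := by
        change (locRingEquiv (RingEquiv.refl T) (Ideal.span ({x, y} : Set T)) (Ideal.span ({y, x} : Set T)) hPQ)
          (algebraMap T _ g) = _
        rw [locRingEquiv_apply]; rfl
      rw [Ideal.map_span, Set.image_singleton, he]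
    have hvec : (fun i => (locRingEquiv (RingEquiv.refl T) (Ideal.span ({x, y} : Set T)) (Ideal.span ({y, x} : Set T)) hPQ)
          ((![algebraMap T (Localization.AtPrime (Ideal.span ({x, y} : Set T))) y,
             algebraMap T (Localization.AtPrime (Ideal.span ({x, y} : Set T))) x] : Fin 2 → _) i)) =
        ![algebraMap T (Localization.AtPrime (Ideal.span ({y, x} : Set T))) y,
          algebraMap T (Localization.AtPrime (Ideal.span ({y, x} : Set T))) x] := by
      funext i
      fin_cases i
      · change (locRingEquiv (RingEquiv.refl T) (Ideal.span ({x, y} : Set T)) (Ideal.span ({y, x} : Set T)) hPQ)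
          (algebraMap T _ y) = algebraMap T _ y
        rw [locRingEquiv_apply]; rfl
      · change (locRingEquiv (RingEquiv.refl T) (Ideal.span ({x, y} : Set T)) (Ideal.span ({y, x} : Set T)) hPQ)
          (algebraMap T _ x) = algebraMap T _ x
        rw [locRingEquiv_apply]; rfl
    have hlexS : IsLexMaxWeightedCentreGerm (Localization.AtPrime (Ideal.span ({y, x} : Set T)))
        (Ideal.span {algebraMap T (Localization.AtPrime (Ideal.span ({y, x} : Set T))) g})
        ![algebraMap T (Localization.AtPrime (Ideal.span ({y, x} : Set T))) y,
          algebraMap T (Localization.AtPrime (Ideal.span ({y, x} : Set T))) x] ![1, 1] (1 * ν) := by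
      have h0 := LexMaxCentre.map_ringEquiv hlexT
        (locRingEquiv (RingEquiv.refl T) (Ideal.span ({x, y} : Set T)) (Ideal.span ({y, x} : Set T)) hPQ)
      rw [hI, hvec] at h0
      exact h0
    have hlexS' := IsLexMaxWeightedCentreGerm.swap_one_one hlexS
    have hyxz₁ : Ideal.span {y, x, z} = maximalIdeal T := by rw [← hxyz, Set.insert_comm]
    have hP₀' : topStratumPrime iotaOrdEps T g = Ideal.span {y, x} := by rw [hP₀, Set.pair_comm]
    have hmem' : g ∈ weightedMonomialIdeal ![y, x - 0 * y ^ 1, z] ![1, 1 + 1, 1] ((1 + 1) * ν) := by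
      rw [zero_mul, sub_zero]
      exact hmem
    exact ⟨inferInstance, hdim3, hε, hq1, y, x, z, 1, 1, 0, hyxz₁, hP₀', ν, hQ, hgν, hgν1, hlexS', hmem'⟩

end CaseB

end Iota3

end Summit.ResolutionOfSingularities.ResolutionOfSingularities.Cruxes.HypersurfaceCentreConstruction.LocalEngine

end
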